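import Literature.NumberTheory.Automorphic.PairLFunctionPolesEqConjArch

/-!
# Crux `PairLBoundaryJS` (stmt-Langlands-13622), line `Sketch` — sub-goal `exists_spreadPairDatum`:
# the spread test datum with exported parameters and a prescribed partner level

Summit `Langlands`, sub-problem `Langlands`, helper file under `Theorems/` supporting the crux
`PairLBoundaryJS` (Arthur–Clozel (1989), Ch. 3, (2.2)), line `Sketch`, registered stub
`stub_hloc_ne_gen` (the finite-place half of the local Rankin–Selberg theory for a PAIR `(W, W')`).

`exists_spreadPairDatum` (**main**) is the pair form of the tree theorem
`Literature.NumberTheory.Automorphic.exists_spreadDatum` (`PairLFunctionPolesEqConjArch`, Part 3):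
for a cuspidal automorphic representation `Π` of `GL_{n+1}(𝔸_K)`, a finite set `T₀` of finite places
AND a prescribed partner level `𝔫' ≠ 0`, there are `T ⊇ T₀`, a depth `m ≥ 1`, a level `𝔫 ≠ 0` with
`𝔫' ∣ 𝔫` and prime factors in `T`, a vector `f ∈ Π` fixed by `K(𝔫)` and a test function
`η = β ⊗ 𝟙_{K_f(𝔫)}` (left `(1, K_f(𝔫))`- and left `K(𝔫)`-invariant; the bump `β` is exported), such
that the Whittaker coefficient of `S_η f` does not vanish at `1` and, at every `v ∈ T`, is spread
bi-equivariant (`IsSpreadWhittakerAt`) for torus parameters `t`, a level exponent `M` and a conductor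
exponent `c₀` satisfying the five inequalities of the support theorem; NEW for the pair: the
`H_v`-isotypy of `S_η f` under the spread level group `spreadLevelGroup t M` is exported, and so is
the inequality `ord_v 𝔫' ≤ M` — so that a partner Whittaker function of level `𝔭_v^{ord_v 𝔫'}` is
invariant under the spread level group at `v`.

What changed with respect to the source: the proof of `exists_spreadDatum` (Part 3 of the source) is
re-run verbatim with the level `𝔫₁` of the initial datum replaced by `𝔫₁ 𝔫'` in the definition
of the level exponents `e_v = max(max(c_v, 0), ord_v(𝔫₁ 𝔫'))`, of the set of places
`T = T₀ ∪ supp(𝔫₁ 𝔫')` and of the level `𝔫 = 𝔫₁ 𝔫' ∏_{v ∈ T} 𝔭_v^{k_v}`; Parts 1–2 of the source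
(`spreadIter`, `spreadLevelIdeal`, `SpreadHyp`, `isotypic_spreadIter`, …) are used as they are.

## References

* H. Jacquet, J. A. Shalika, *On Euler products and the classification of automorphic
  representations I*, Amer. J. Math. 103 (1981), §4–§5 [JacquetShalikaAJM1981].
* J. Arthur, L. Clozel, *Simple algebras, base change, and the advanced theory of the trace
  formula* (1989), Ch. 3, (2.2)–(2.3) [ArthurClozelAMS120].
* H. Jacquet, I. I. Piatetski-Shapiro, J. Shalika, *Conducteur des représentations du groupe
  linéaire*, Math. Ann. 256 (1981), §5.
-/

noncomputable section

-- `Summit.Langlands.Langlands.…` (summit = sub-problem name, D-0017 layout) trips `dupNamespace`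
set_option linter.dupNamespace false

open scoped MatrixGroups Topology Pointwise ENNReal NNReal ComplexConjugate InnerProductSpace
open NumberField IsDedekindDomain MeasureTheory Measure Matrix Set Filter
open Literature.NumberTheory.Automorphic AdelicGroupData
open Literature.NumberTheory.GaloisRepresentations (ideleGroup)

-- the automorphic quotient carries the tree's Borel σ-algebra, not Mathlib's quotient σ-algebra
attribute [-instance] Quotient.instMeasurableSpace QuotientGroup.measurableSpace

-- the house local instances, exactly as in `RankinSelbergUnfoldingIdentity`
attribute [local instance] adelicBorel borelSpace_adelic locallyCompactSpace_adelic secondCountableTopology_gl_adelic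
  glAdeleBorel borelSpace_glAdele borelSpace_ideleGroup secondCountableTopology_ideleGroup

namespace Summit.Langlands.Langlands.Theorems.SpreadPairDatum

open ValuativeRel
open WithZero NumberField.mixedEmbedding
open scoped ContDiff Matrix.Norms.Operator
open Literature.NumberTheory.Automorphic.WhittakerSupport

-- the local instances of the source (`PairLFunctionPolesEqConjArch`, Part 3, section `Final`)
attribute [local instance] glInfBorel borelSpace_glInf locallyCompactSpace_glInf secondCountableTopology_glInf

-- Mathlib idiom: the commutator Lie ring on matrices, to mention `(archGroupGL n K).lie`
attribute [local instance 100] LieRing.ofAssociativeRing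

attribute [local instance] finiteDimensional_matrix_mixedSpace

set_option maxHeartbeats 1600000 in
set_option synthInstance.maxHeartbeats 200000 in
set_option backward.isDefEq.respectTransparency false in
/-- **The spread test datum of a cuspidal automorphic representation with a prescribed partner
level.** For a cuspidal automorphic representation `Π` of `GL_{n+1}(𝔸_K)`, a finite set `T₀` of
finite places and an ideal `𝔫' ≠ 0` there are `T ⊇ T₀`, a depth `m ≥ 1`, a level `𝔫 ≠ 0` with
`𝔫' ∣ 𝔫` and prime factors in `T`, `f ∈ Π` fixed by `K(𝔫)` and a test function
`η = β ⊗ 𝟙_{K_f(𝔫)}` (`β` continuous of compact support on `GL_{n+1}(K_∞)`), left `(1, K_f(𝔫))`- and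
left `K(𝔫)`-invariant, such that the Whittaker coefficient of `S_η f` does not vanish at `1`
(every Haar measure on `N(𝔸_K)`) and, at every `v ∈ T`, there are torus parameters `t`, a level
exponent `M` and a conductor exponent `c₀` with: the Whittaker coefficient is spread bi-equivariant
(`IsSpreadWhittakerAt v ψ t M`), `S_η f` is `H_v`-isotypic under `spreadLevelGroup t M`
(`Π(ι_v h) S_η f = χ_v(h) S_η f`), `ψ_v` is non-trivial on `𝔭_v^{c₀ - 1}`, `1 ≤ M`, `ord_v 𝔫' ≤ M`,
`|t_j| ≤ |t_i|` for `i ≤ j`, `exp(M - c₀) |t_{i+1}| ≤ |t_i|`, `exp(-m) |t_0| ≤ exp(-M) |t_n|`.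
The pair form of `Literature.NumberTheory.Automorphic.exists_spreadDatum`: its proof re-run with the
initial level `𝔫₁` replaced by `𝔫₁ 𝔫'` in the level exponents `e_v = max(max(c_v,0), ord_v(𝔫₁𝔫'))`,
the places `T = T₀ ∪ supp(𝔫₁ 𝔫')` and the level `𝔫 = 𝔫₁ 𝔫' ∏_{v ∈ T} 𝔭_v^{k_v}` (`f = E_T f₁`,
`E_T` the iterated spread projector; Jacquet–Shalika (1981) §4–§5, JPSS (1981) §5,
Arthur–Clozel (1989) Ch. 3 (2.2)–(2.3)). -/
theorem exists_spreadPairDatum :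
    ∀ {n : ℕ} {K : Type} [Field K] [NumberField K]
      {μ : Measure (AdelicGroupData.gl (n + 1) K).automorphicQuotient}
      [(AdelicGroupData.gl (n + 1) K).IsAutomorphicMeasure μ]
      [MeasurableSpace (AdeleRing (𝓞 K) K)] [BorelSpace (AdeleRing (𝓞 K) K)]
      (P : CuspidalAutomorphicRepGL (n + 1) K μ) (T₀ : Finset (HeightOneSpectrum (𝓞 K)))
      {𝔫' : Ideal (𝓞 K)} (_ : 𝔫' ≠ 0),
    ∃ (T : Finset (HeightOneSpectrum (𝓞 K))) (_ : T₀ ⊆ T) (m : ℕ) (𝔫 : Ideal (𝓞 K)) (_ : 𝔫 ≠ 0) (_ : 𝔫' ∣ 𝔫)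
      (_ : ∀ v : HeightOneSpectrum (𝓞 K), v.asIdeal ∣ 𝔫 → v ∈ T)
      (f : P.1.toSubmodule) (η : GL (Fin (n + 1)) (AdeleRing (𝓞 K) K) → ℝ), IsTestFunctionGL (n + 1) K η ∧
      (∃ β : GL (Fin (n + 1)) (mixedSpace K) → ℝ, Continuous β ∧ HasCompactSupport β ∧
        η = archLevelWeight (finitePrincipalCongruenceLevel (n + 1) K 𝔫) β) ∧
      (∀ g : (AdelicGroupData.gl (n + 1) K).Adelic, g ∈ principalCongruenceLevel (n + 1) K 𝔫 → P.1.toContRep g f = f) ∧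
      (∀ u ∈ finitePrincipalCongruenceLevel (n + 1) K 𝔫, ∀ g : GL (Fin (n + 1)) (AdeleRing (𝓞 K) K),
        η (GLn.ofFinite (n + 1) K u * g) = η g) ∧
      (∀ k : (AdelicGroupData.gl (n + 1) K).Adelic, k ∈ principalCongruenceLevel (n + 1) K 𝔫 →
        ∀ g : (AdelicGroupData.gl (n + 1) K).Adelic, η (k * g) = η g) ∧
      (∀ (ν₀ : Measure ↥(adelicUnipotent (n + 1) K)) (_ : IsHaarMeasure ν₀),
        whittakerCoeff ν₀ (unipotentTateDomain (n + 1) K) (adeleAddChar K)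
          (invQuot (AdelicGroupData.gl (n + 1) K) (smoothedForm η (f : (AdelicGroupData.gl (n + 1) K).L2 μ))) 1 ≠ 0) ∧
      1 ≤ m ∧
      ∀ (ν₀ : Measure ↥(adelicUnipotent (n + 1) K)) (_ : IsHaarMeasure ν₀), ∀ v ∈ T,
        ∃ (t : Fin (n + 1) → (v.adicCompletion K)ˣ) (M c₀ : ℤ),
          IsSpreadWhittakerAt v (adeleAddChar K) t M
            (whittakerCoeff ν₀ (unipotentTateDomain (n + 1) K) (adeleAddChar K)
              (invQuot (AdelicGroupData.gl (n + 1) K) (smoothedForm η (f : (AdelicGroupData.gl (n + 1) K).L2 μ)))) ∧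
          (∀ h ∈ spreadLevelGroup t M,
            P.1.toContRep (GLn.ofLocal (n + 1) K v h) (smoothedVector P.1 η f) = spreadChar v h • smoothedVector P.1 η f) ∧
          (∃ x : v.adicCompletion K, Valued.v x ≤ exp (1 - c₀) ∧ (adeleAddChar K).adicComponent v x ≠ 1) ∧ 1 ≤ M ∧
          ((Associates.mk v.asIdeal).count (Associates.mk 𝔫').factors : ℤ) ≤ M ∧
          (∀ i j : Fin (n + 1), i ≤ j → Valued.v (t j : v.adicCompletion K) ≤ Valued.v (t i : v.adicCompletion K)) ∧
          (∀ i j : Fin (n + 1), (i : ℕ) + 1 = j →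
            exp (M - c₀) * Valued.v (t j : v.adicCompletion K) ≤ Valued.v (t i : v.adicCompletion K)) ∧
          exp (-(m : ℤ)) * Valued.v (t 0 : v.adicCompletion K) ≤
            exp (-M) * Valued.v (t (Fin.last n) : v.adicCompletion K) := by
  intro n K _ _ μ _ _ _ P T₀ 𝔫' h𝔫'
  classical
  obtain ⟨𝔫₁, h𝔫₁, f₁, ψ, hψ, hβs, hf₁fix, hW1⟩ := exists_initialDatum P (Nat.succ_pos n)
  set β : GL (Fin (n + 1)) (mixedSpace K) → ℝ := fun u => ψ u with hβdef
  have hβc : Continuous β := hψ.continuous.comp Units.continuous_val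
  -- the enlarged initial level `𝔫₂ = 𝔫₁ 𝔫'` (the only change with respect to `exists_spreadDatum`)
  set 𝔫₂ : Ideal (𝓞 K) := 𝔫₁ * 𝔫' with h𝔫₂def
  have h𝔫₂ : 𝔫₂ ≠ 0 := mul_ne_zero h𝔫₁ h𝔫'
  have hf₁fix₂ : ∀ g ∈ principalCongruenceLevel (n + 1) K 𝔫₂, P.1.toContRep g f₁ = f₁ := fun g hg =>
    hf₁fix g (principalCongruenceLevel_mono (n + 1) K h𝔫₂ Ideal.mul_le_right hg)
  -- per-place data
  have hcond : ∀ v : HeightOneSpectrum (𝓞 K), ∃ d : ℤ, ((adeleAddChar K).adicComponent v).HasConductorExp d := fun v =>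
    ((isGlobalAddChar_adeleAddChar (K := K)).isContinuousNontrivial_adicComponent
      (adicComponent_adeleAddChar_ne_one v)).exists_hasConductorExp
  choose c hc using hcond
  obtain ⟨ϖ, hϖ⟩ := exists_uniformizers (K := K)
  set cnt : HeightOneSpectrum (𝓞 K) → ℕ := fun v => (Associates.mk v.asIdeal).count (Associates.mk 𝔫₂).factors with hcnt
  set e : HeightOneSpectrum (𝓞 K) → ℤ := fun v => max (max (c v) 0) (cnt v : ℤ) with he
  have hH : ∀ v, SpreadHyp (K := K) c e ϖ v := fun v =>
    { cond := fun y hy => (hc v).1 y ((mem_primePowBall_adicCompletion_iff (v := v)).2 hy)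
      e_nonneg := le_trans (le_max_right _ _) (le_max_left _ _)
      c_le_e := le_trans (le_max_left _ _) (le_max_left _ _)
      unif := hϖ v }
  have hrad : ∀ v, exp (-e v) ≤ idealRadius K v 𝔫₂ := fun v => by
    rw [idealRadius_eq_exp_neg_natCast v h𝔫₂, exp_le_exp, neg_le_neg_iff]
    exact le_max_right _ _
  have hcnt' : ∀ v, ((Associates.mk v.asIdeal).count (Associates.mk 𝔫').factors : ℤ) ≤ spreadM (c v) (e v) := by
    intro v
    have h1 : (Associates.mk v.asIdeal).count (Associates.mk 𝔫').factors ≤ cnt v :=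
      Associates.count_le_count_of_le (Associates.mk_ne_zero.2 h𝔫₂) v.associates_irreducible
        (Associates.mk_le_mk_of_dvd (dvd_mul_left 𝔫' 𝔫₁))
    have h2 : (cnt v : ℤ) ≤ e v := le_max_right _ _
    calc ((Associates.mk v.asIdeal).count (Associates.mk 𝔫').factors : ℤ) ≤ (cnt v : ℤ) := by exact_mod_cast h1
      _ ≤ spreadM (c v) (e v) := h2.trans (le_spreadM (c v) (e v))
  -- the places, the vector, the level
  set T : Finset (HeightOneSpectrum (𝓞 K)) := T₀ ∪ (Ideal.finite_factors h𝔫₂).toFinset with hT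
  set L : List (HeightOneSpectrum (𝓞 K)) := T.toList with hL
  have hnd : L.Nodup := Finset.nodup_toList T
  have hLT : ∀ v, v ∈ L ↔ v ∈ T := fun v => Finset.mem_toList
  set k : HeightOneSpectrum (𝓞 K) → ℕ := fun v => spreadK (n + 1) (c v) (e v) with hk
  set f : P.1.toSubmodule := spreadIter P.1 c e ϖ L f₁ with hf
  set 𝔫 : Ideal (𝓞 K) := spreadLevelIdeal 𝔫₂ k L with h𝔫def
  have h𝔫 : 𝔫 ≠ 0 := spreadLevelIdeal_ne_zero h𝔫₂ k L
  have h𝔫'dvd : 𝔫' ∣ 𝔫 := Ideal.dvd_iff_le.2 ((spreadLevelIdeal_le 𝔫₂ k L).trans Ideal.mul_le_left)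
  have hprimes : ∀ v : HeightOneSpectrum (𝓞 K), v.asIdeal ∣ 𝔫 → v ∈ T := by
    intro v hv
    rcases mem_or_dvd_of_dvd_spreadLevelIdeal k hv with h | h
    · exact Finset.mem_union_right _ ((Ideal.finite_factors h𝔫₂).mem_toFinset.2 h)
    · exact (hLT v).1 h
  have hffix : ∀ g ∈ principalCongruenceLevel (n + 1) K 𝔫, P.1.toContRep g f = f :=
    toContRep_spreadIter_of_mem_principalCongruenceLevel h𝔫₂ (fun v _ => hH v) hnd hf₁fix₂
  have hffixK : ∀ u ∈ finitePrincipalCongruenceLevel (n + 1) K 𝔫, P.1.toContRep (GLn.ofFinite (n + 1) K u) f = f :=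
    fun u hu => hffix _ (mem_finitePrincipalCongruenceLevel_iff.1 hu)
  have hKo := isOpen_finitePrincipalCongruenceLevel (n + 1) K h𝔫
  have hKc := isCompact_finitePrincipalCongruenceLevel (n + 1) K h𝔫
  set η : GL (Fin (n + 1)) (AdeleRing (𝓞 K) K) → ℝ := archLevelWeight (finitePrincipalCongruenceLevel (n + 1) K 𝔫) β with hηdef
  have hη : IsTestFunctionGL (n + 1) K η :=
    isTestFunctionGL_archLevelWeight hβc hβs (fun u => contDiff_coe_comp_mul_expGL hψ u) hKo hKc
  have hηleft : ∀ u ∈ finitePrincipalCongruenceLevel (n + 1) K 𝔫, ∀ g : GL (Fin (n + 1)) (AdeleRing (𝓞 K) K),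
      η (GLn.ofFinite (n + 1) K u * g) = η g := fun u hu g => archLevelWeight_ofFinite_mul β hu g
  have hηleft' : ∀ k' : (AdelicGroupData.gl (n + 1) K).Adelic, k' ∈ principalCongruenceLevel (n + 1) K 𝔫 →
      ∀ g : (AdelicGroupData.gl (n + 1) K).Adelic, η (k' * g) = η g := by
    intro k' hk' g
    have h1 : GLn.ofFinite (n + 1) K (GLn.sndHom (n + 1) K k') = k' :=
      GLn.ofFinite_sndHom_of_mem (principalCongruenceLevel_le (n + 1) K 𝔫 hk')
    have h2 : GLn.sndHom (n + 1) K k' ∈ finitePrincipalCongruenceLevel (n + 1) K 𝔫 := by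
      rw [mem_finitePrincipalCongruenceLevel_iff, h1]; exact hk'
    have h3 := hηleft _ h2 g
    rwa [h1] at h3
  -- the initial smoothed vector `x₁` (level `𝔫₁`) and the formula `S_η f = a • E_L x₁`
  set η₁ : GL (Fin (n + 1)) (AdeleRing (𝓞 K) K) → ℝ := archLevelWeight (finitePrincipalCongruenceLevel (n + 1) K 𝔫₁) β with hη₁def
  have hK₁o := isOpen_finitePrincipalCongruenceLevel (n + 1) K h𝔫₁
  have hK₁c := isCompact_finitePrincipalCongruenceLevel (n + 1) K h𝔫₁
  have hη₁ : IsTestFunctionGL (n + 1) K η₁ :=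
    isTestFunctionGL_archLevelWeight hβc hβs (fun u => contDiff_coe_comp_mul_expGL hψ u) hK₁o hK₁c
  set x₁ : P.1.toSubmodule := smoothedVector P.1 η₁ f₁ with hx₁
  have hx₁G : x₁ ∈ gardingSpace P.1 := smoothedVector_mem_gardingSpace hη₁ f₁
  have hx₁fix : ∀ g ∈ principalCongruenceLevel (n + 1) K 𝔫₁, P.1.toContRep g x₁ = x₁ := by
    intro g hg
    rw [hx₁, toContRep_smoothedVector_eq _ hη₁.continuous hη₁.hasCompactSupport g f₁]
    congr 1
    funext x
    have h1 : GLn.ofFinite (n + 1) K (GLn.sndHom (n + 1) K g⁻¹) = g⁻¹ :=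
      GLn.ofFinite_sndHom_of_mem (principalCongruenceLevel_le (n + 1) K 𝔫₁ (inv_mem hg))
    have h2 : GLn.sndHom (n + 1) K g⁻¹ ∈ finitePrincipalCongruenceLevel (n + 1) K 𝔫₁ := by
      rw [mem_finitePrincipalCongruenceLevel_iff, h1]; exact inv_mem hg
    have h3 := archLevelWeight_ofFinite_mul β h2 x
    rw [h1] at h3
    exact h3
  have hx₁fix₂ : ∀ g ∈ principalCongruenceLevel (n + 1) K 𝔫₂, P.1.toContRep g x₁ = x₁ := fun g hg =>
    hx₁fix g (principalCongruenceLevel_mono (n + 1) K h𝔫₂ Ideal.mul_le_right hg)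
  have hf₁fixK : ∀ u ∈ finitePrincipalCongruenceLevel (n + 1) K 𝔫₁, P.1.toContRep (GLn.ofFinite (n + 1) K u) f₁ = f₁ :=
    fun u hu => hf₁fix _ (mem_finitePrincipalCongruenceLevel_iff.1 hu)
  set c𝔫 : ℝ := (archShadowConst (n := n + 1) (K := K) hKo
    (by rw [((finitePrincipalCongruenceLevel (n + 1) K 𝔫).isClosed_of_isOpen hKo).closure_eq]; exact hKc) : ℝ) with hc𝔫
  set c₁ : ℝ := (archShadowConst (n := n + 1) (K := K) hK₁o
    (by rw [((finitePrincipalCongruenceLevel (n + 1) K 𝔫₁).isClosed_of_isOpen hK₁o).closure_eq]; exact hK₁c) : ℝ) with hc₁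
  have hc₁pos : 0 < c₁ := archShadowConst_pos _ hK₁o hK₁c
  have hc𝔫pos : 0 < c𝔫 := archShadowConst_pos _ hKo hKc
  have hI : ∫ h, (β h : ℂ) • P.1.toContRep (GLn.ofInfinite (n + 1) K h) f₁ ∂(archHaar (n + 1) K) = ((c₁⁻¹ : ℝ) : ℂ) • x₁ := by
    rw [hx₁, hη₁def, smoothedVector_archLevelWeight_eq_smul_archIntegral hβc hβs hK₁o hK₁c hf₁fixK, smul_smul]
    push_cast
    rw [inv_mul_cancel₀ (by exact_mod_cast hc₁pos.ne'), one_smul]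
  have hu : smoothedVector P.1 η f = ((c𝔫 * c₁⁻¹ : ℝ) : ℂ) • spreadIter P.1 c e ϖ L x₁ := by
    rw [hηdef, smoothedVector_archLevelWeight_eq_smul_archIntegral hβc hβs hKo hKc hffixK, hf,
      ← spreadIter_archIntegral (fun v _ => hH v) hβc hβs, hI, spreadIter_smul, smul_smul]
    push_cast
    rfl
  -- the depth
  set m : ℕ := 1 + ∑ v ∈ T, (spreadM (c v) (e v) + n * (spreadM (c v) (e v) - c v)).toNat with hm
  have hmv : ∀ v ∈ T, spreadM (c v) (e v) + n * (spreadM (c v) (e v) - c v) ≤ m := by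
    intro v hv
    have h1 : (spreadM (c v) (e v) + n * (spreadM (c v) (e v) - c v)).toNat ≤
        ∑ w ∈ T, (spreadM (c w) (e w) + n * (spreadM (c w) (e w) - c w)).toNat :=
      Finset.single_le_sum (f := fun w => (spreadM (c w) (e w) + n * (spreadM (c w) (e w) - c w)).toNat)
        (fun _ _ => Nat.zero_le _) hv
    have h2 := Int.self_le_toNat (spreadM (c v) (e v) + n * (spreadM (c v) (e v) - c v))
    have h3 : ((∑ w ∈ T, (spreadM (c w) (e w) + n * (spreadM (c w) (e w) - c w)).toNat : ℕ) : ℤ) ≤ (m : ℤ) := by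
      rw [hm]; exact_mod_cast Nat.le_add_left _ _
    calc spreadM (c v) (e v) + n * (spreadM (c v) (e v) - c v)
        ≤ ((spreadM (c v) (e v) + n * (spreadM (c v) (e v) - c v)).toNat : ℤ) := h2
      _ ≤ ((∑ w ∈ T, (spreadM (c w) (e w) + n * (spreadM (c w) (e w) - c w)).toNat : ℕ) : ℤ) := by exact_mod_cast h1
      _ ≤ m := h3
  refine ⟨T, Finset.subset_union_left, m, 𝔫, h𝔫, h𝔫'dvd, hprimes, f, η, hη, ⟨β, hβc, hβs, rfl⟩, hffix, hηleft, hηleft',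
    fun ν₀ hν₀ => ?_, by omega, fun ν₀ hν₀ v hv => ?_⟩
  · -- non-vanishing at `1`
    haveI := hν₀
    have huG : smoothedVector P.1 η f ∈ gardingSpace P.1 := smoothedVector_mem_gardingSpace hη f
    obtain ⟨hEG, hℓ⟩ := whittakerFunctional_spreadIter ν₀ h𝔫₂ (fun v _ => hH v) hnd (fun v _ => hrad v) hx₁G hx₁fix₂
      (W := P.1) (c := c) (e := e) (ϖ := ϖ) (L := L)
    have hWu := whittakerFunctional_toContRep_eq_whittakerCoeff ν₀ (continuous_adeleAddChar K) huG
      (hasContRep_smoothedVector P.1 hη.continuous hη.hasCompactSupport f) 1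
    have hWx := whittakerFunctional_toContRep_eq_whittakerCoeff ν₀ (continuous_adeleAddChar K) hx₁G
      (hasContRep_smoothedVector P.1 hη₁.continuous hη₁.hasCompactSupport f₁) 1
    change whittakerCoeff ν₀ (unipotentTateDomain (n + 1) K) (adeleAddChar K)
      (invQuot (AdelicGroupData.gl (n + 1) K) (smoothedForm η (f : (AdelicGroupData.gl (n + 1) K).L2 μ))) 1 ≠ 0
    rw [← hWu]
    have hvec : (⟨P.1.toContRep 1 (smoothedVector P.1 η f), toContRep_mem_gardingSpace _ huG⟩ : gardingSpace P.1) =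
        ((c𝔫 * c₁⁻¹ : ℝ) : ℂ) • ⟨spreadIter P.1 c e ϖ L x₁, hEG⟩ := by
      apply Subtype.ext
      change P.1.toContRep 1 (smoothedVector P.1 η f) = ((c𝔫 * c₁⁻¹ : ℝ) : ℂ) • spreadIter P.1 c e ϖ L x₁
      rw [DFunLike.congr_fun (map_one P.1.toContRep) (smoothedVector P.1 η f)]
      exact hu
    have hvec1 : (⟨x₁, hx₁G⟩ : gardingSpace P.1) = ⟨P.1.toContRep 1 x₁, toContRep_mem_gardingSpace _ hx₁G⟩ := by
      apply Subtype.ext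
      exact (DFunLike.congr_fun (map_one P.1.toContRep) x₁).symm
    rw [hvec, map_smul, smul_eq_mul, hℓ, hvec1, hWx]
    exact mul_ne_zero (by exact_mod_cast (mul_pos hc𝔫pos (inv_pos.2 hc₁pos)).ne') (hW1 ν₀ hν₀)
  · -- the data at `v ∈ T`
    haveI := hν₀
    have hv' : v ∈ L := (hLT v).2 hv
    have hisoF := isotypic_spreadIter (W := P.1) (fun v _ => hH v) hnd f₁ v hv'
    have hisoI := isotypic_archIntegral hisoF hβc hβs
    have hiso : ∀ h ∈ spreadLevelGroup (spreadTorus (n + 1) (ϖ v) (c v) (e v)) (spreadM (c v) (e v)),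
        P.1.toContRep (GLn.ofLocal (n + 1) K v h) (smoothedVector P.1 η f) = spreadChar v h • smoothedVector P.1 η f := by
      intro h hh
      rw [hηdef, smoothedVector_archLevelWeight_eq_smul_archIntegral hβc hβs hKo hKc hffixK, map_smul, hf, hisoI h hh,
        smul_comm]
    obtain ⟨x, hx, hx1⟩ := (hc v).2
    refine ⟨spreadTorus (n + 1) (ϖ v) (c v) (e v), spreadM (c v) (e v), c v,
      isSpreadWhittakerAt_of_isotypic ν₀ (le_trans zero_le_one (one_le_spreadM (hH v).e_nonneg)) (hH v).hψ hη f hiso,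
      hiso, ⟨x, ?_, hx1⟩, one_le_spreadM (hH v).e_nonneg, hcnt' v,
      valuation_spreadTorus_antitone (hH v).e_nonneg (hH v).unif,
      valuation_spreadTorus_gap (hH v).unif, valuation_spreadTorus_depth (hH v).unif (hmv v hv)⟩
    have h1 := (mem_primePowBall_adicCompletion_iff (v := v)).1 hx
    rwa [show (-(c v - 1) : ℤ) = 1 - c v by ring] at h1

end Summit.Langlands.Langlands.Theorems.SpreadPairDatum
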